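import Mathlib
import HarnessLib
import Summits.PneNP.PneNP.Theorems.RamseyUncertifiablePaleySosRungCrossNormAux3

/-!
# Cross-matrix norm bounds from star codegrees (stub `stub_crossNormOfCodegrees`)

The registered stub (D) `stub_crossNormOfCodegrees` of crux stmt-PneNP-9817
(`Summit.PneNP.PneNP.Theses.RamseyUncertifiable.PaleySosRung`, line `weil-patch-transfer`):
for a graph `G` on `Fin m` whose star codegrees concentrate (exponent `9/16`), the rectangular
Meka–Potechin–Wigderson cross matrices `R_{a,b}` (`a`-sets × `b`-sets,
`R[V,W] = [V ∩ W = ∅]·(2^{ab}·[V × W ⊆ E(G)] - 1)`) satisfy the bilinear operator-norm bound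
`|uᵀ R_{a,b} v| ≤ m^{(a+b)/2 - 1/8} ‖u‖ ‖v‖` for `1 ≤ a, b ≤ r` and `m ≥ m₀(r)` — a power saving
over the trivial `m^{(a+b)/2}`.

The mathematics (deterministic linear algebra, no probability):
`R[V,W] = Π_{w ∈ W}(1 + τ(V,w)) - 1 + [V ∩ W ≠ ∅]` with `τ(V,w) = 2^a·[V ⊆ N(w)] - 1`
(`CrossNorm.cross_entry_eq`), hence `R = Σ_{k=1}^{b} T_k N_k + E`;
`|uᵀ E v| ≤ √(ab)·m^{(a+b)/2-1}‖u‖‖v‖`; `|uᵀ T_k N_k v| ≤ ‖T_kᵀ u‖ ‖N_k v‖` with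
`‖N_k v‖² ≤ 2^b m^{b-k} ‖v‖²` and, by the Schur test,
`‖T_kᵀ u‖² ≤ ‖u‖² · max_V Σ_{V'} |e_k(τ(V,·)τ(V',·))|`, the elementary symmetric functions being
controlled by the Newton bound `|e_k| ≤ max(|p_1|, 4^r √m)^k` with `|p_1| ≲ m^{9/16}` for
disjoint `V, V'` (the hypothesis) and `|p_1| ≲ m` for the `≤ a m^{a-1}` sets `V'` meeting `V`.
All of this is in the auxiliary files `…CrossNormAux1/2/3` (culminating in the graph-free
`cn_bilinearBound`); this file specialises to the graph and does the exponent bookkeeping.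

References: R. Meka, A. Potechin, A. Wigderson, *Sum-of-squares lower bounds for planted
clique*, STOC 2015 / arXiv:1503.06447, §8.2 (the matrices); the Schur test and Newton's
identities are folklore (Mathlib `MvPolynomial.mul_esymm_eq_sum`).
-/

set_option linter.dupNamespace false -- `Summit.PneNP.PneNP.…`: summit = sub-problem (D-0017)

namespace Summit.PneNP.PneNP.Theorems.PaleySosRungWeilPatch

open Finset CrossNorm

/-- **(D) Codegree concentration ⇒ rectangular cross-matrix norm bounds with a power saving**
(registered stub `stub_crossNormOfCodegrees` of crux stmt-PneNP-9817, line `weil-patch-transfer`;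
deterministic). For every `r` there is `m₀` (here `m₀ = C^16`, `C = (r+1)²·2^r·K^r·(r+1)`,
`K = 1 + 4^r(2r+1)`) such that every graph `G` on `Fin m`, `m ≥ m₀`, whose star codegrees
`codeg(A,A') = Σ_{w ∉ A ∪ A'} τ(A,w)τ(A',w)`, `τ(A,w) = 2^{|A|}·[A ⊆ N(w)] - 1`, are within
`m^{9/16}` of `(2^{|A ∩ A'|} - 1)(m - |A ∪ A'|)` for all pairs of distinct `a`-sets, `1 ≤ a ≤ r`,
satisfies, for all `1 ≤ a, b ≤ r`, the bilinear bound `|uᵀ R_{a,b} v| ≤ m^{(a+b)/2 - 1/8} ‖u‖ ‖v‖`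
for the rectangular MPW cross matrix `R_{a,b}[V,W] = [V ∩ W = ∅]·(2^{ab}·[V × W ⊆ E(G)] - 1)` on
`a`-sets × `b`-sets. Proof: only the DISJOINT pairs of the hypothesis are used (there the mean
term vanishes), giving `CrossNorm.abs_bilinear_le` with `D = m^{9/16}` (so `√m ≤ D ≤ m`) after
`CrossNorm.cross_entry_eq`; the resulting bound `√(C m^{a+b-1} m^{9/16}) ‖u‖ ‖v‖` is at most
`m^{(a+b)/2 - 1/8} ‖u‖ ‖v‖` as soon as `C ≤ m^{3/16}`, which holds for `m ≥ C^16`. The sums over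
the subtypes `{S // S.card = a}` are converted to sums over `Finset.powersetCard a univ` by
`Finset.sum_subtype`. [folklore; matrices of arXiv:1503.06447 §8.2] -/
theorem stub_crossNormOfCodegrees :
    ∀ r : ℕ, ∃ m₀ : ℕ, ∀ m ≥ m₀, ∀ (G : SimpleGraph (Fin m)) [DecidableRel G.Adj],
      (∀ a : ℕ, 1 ≤ a → a ≤ r → ∀ A A' : Finset (Fin m), A.card = a → A'.card = a → A ≠ A' →
          |(∑ w ∈ (Finset.univ \ (A ∪ A')),
              (if ∀ x ∈ A, G.Adj x w then (2 : ℝ) ^ a - 1 else -1) *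
              (if ∀ x ∈ A', G.Adj x w then (2 : ℝ) ^ a - 1 else -1))
            - ((2 : ℝ) ^ (A ∩ A').card - 1) * ((m : ℝ) - ((A ∪ A').card : ℝ))|
            ≤ (m : ℝ) ^ ((9 : ℝ) / 16)) →
      ∀ a b : ℕ, 1 ≤ a → a ≤ r → 1 ≤ b → b ≤ r →
        ∀ (u : {S : Finset (Fin m) // S.card = a} → ℝ) (v : {S : Finset (Fin m) // S.card = b} → ℝ),
          |∑ A, ∑ B, u A * v B *
              (if Disjoint A.1 B.1 then
                (if ∀ x ∈ A.1, ∀ y ∈ B.1, G.Adj x y then (2 : ℝ) ^ (a * b) - 1 else -1)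
               else 0)|
            ≤ (m : ℝ) ^ (((a + b : ℕ) : ℝ) / 2 - 1 / 8) *
                Real.sqrt (∑ A, u A ^ 2) * Real.sqrt (∑ B, v B ^ 2) := by
  intro r
  set Cn : ℕ := (r + 1) ^ 2 * (2 ^ r * (1 + 4 ^ r * (2 * r + 1)) ^ r * (r + 1)) with hCn
  have hCn1 : 1 ≤ Cn := Nat.succ_le_of_lt (by rw [hCn]; positivity)
  refine ⟨Cn ^ 16, ?_⟩
  intro m hm G _ hcodeg a b ha har hb hbr u v
  have hm1 : 1 ≤ m := le_trans (Nat.one_le_pow _ _ hCn1) hm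
  have hN1 : (1 : ℝ) ≤ (m : ℝ) := by exact_mod_cast hm1
  have hN0 : (0 : ℝ) < (m : ℝ) := by linarith
  set D : ℝ := (m : ℝ) ^ ((9 : ℝ) / 16) with hD
  have hD1 : 1 ≤ D := Real.one_le_rpow hN1 (by norm_num)
  have hD0 : 0 ≤ D := zero_le_one.trans hD1
  have hDN : D ≤ (m : ℝ) := by
    have := Real.rpow_le_rpow_of_exponent_le hN1 (show (9 : ℝ) / 16 ≤ 1 by norm_num)
    rwa [Real.rpow_one] at this
  have hsqrt : Real.sqrt (m : ℝ) ≤ D := by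
    rw [Real.sqrt_eq_rpow]
    exact Real.rpow_le_rpow_of_exponent_le hN1 (by norm_num)
  -- the extended coefficient vectors
  set u' : Finset (Fin m) → ℝ := fun S => if h : S.card = a then u ⟨S, h⟩ else 0 with hu'
  set v' : Finset (Fin m) → ℝ := fun S => if h : S.card = b then v ⟨S, h⟩ else 0 with hv'
  have hu : ∀ A : {S : Finset (Fin m) // S.card = a}, u A = u' A.1 := fun A => by
    simp [hu', A.2]
  have hv : ∀ B : {S : Finset (Fin m) // S.card = b}, v B = v' B.1 := fun B => by
    simp [hv', B.2]
  -- the hypotheses of the master bound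
  have hτb : ∀ (V : Finset (Fin m)) (w : Fin m),
      |(if ∀ x ∈ V, G.Adj x w then (2 : ℝ) ^ a - 1 else -1)| ≤ (2 : ℝ) ^ r := by
    intro V w
    split_ifs
    · rw [abs_of_nonneg (by linarith [one_le_pow₀ (M₀ := ℝ) one_le_two (n := a)])]
      linarith [pow_le_pow_right₀ (one_le_two (α := ℝ)) har]
    · rw [abs_neg, abs_one]
      exact one_le_pow₀ one_le_two
  have hRdec : ∀ V ∈ powersetCard a (univ : Finset (Fin m)),
      ∀ W ∈ powersetCard b (univ : Finset (Fin m)),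
        (if Disjoint V W then
            (if ∀ x ∈ V, ∀ y ∈ W, G.Adj x y then (2 : ℝ) ^ (a * b) - 1 else -1) else 0)
          = (∏ w ∈ W, (1 + (if ∀ x ∈ V, G.Adj x w then (2 : ℝ) ^ a - 1 else -1))) - 1
            + (if Disjoint V W then 0 else 1) :=
    fun V _ W hW => by convert cross_entry_eq G a b V W (mem_powersetCard_univ.1 hW)
  have hyp : ∀ V ∈ powersetCard a (univ : Finset (Fin m)),
      ∀ V' ∈ powersetCard a (univ : Finset (Fin m)), Disjoint V V' →
        |∑ w ∈ univ \ (V ∪ V'), (if ∀ x ∈ V, G.Adj x w then (2 : ℝ) ^ a - 1 else -1)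
            * (if ∀ x ∈ V', G.Adj x w then (2 : ℝ) ^ a - 1 else -1)| ≤ D := by
    intro V hV V' hV' hdj
    have hVa := mem_powersetCard_univ.1 hV
    have hV'a := mem_powersetCard_univ.1 hV'
    have hne : V ≠ V' := by
      rintro rfl
      rw [disjoint_self, Finset.bot_eq_empty] at hdj
      rw [hdj, card_empty] at hVa
      omega
    have h := hcodeg a ha har V V' hVa hV'a hne
    have hint : (V ∩ V').card = 0 := by
      rw [Finset.disjoint_iff_inter_eq_empty.1 hdj, card_empty]
    rw [hint, pow_zero, sub_self, zero_mul, sub_zero] at h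
    exact h
  have hC : ((r : ℝ) + 1) ^ 2 * (2 ^ r * (1 + (4 : ℝ) ^ r * (2 * r + 1)) ^ r * (r + 1))
      ≤ (Cn : ℝ) := by
    rw [hCn]; push_cast; exact le_rfl
  have hDN' : D ≤ (Fintype.card (Fin m) : ℝ) := by rw [Fintype.card_fin]; exact hDN
  have hsqrt' : Real.sqrt (Fintype.card (Fin m) : ℝ) ≤ D := by rw [Fintype.card_fin]; exact hsqrt
  have main := abs_bilinear_le (α := Fin m)
    (fun V w => if ∀ x ∈ V, G.Adj x w then (2 : ℝ) ^ a - 1 else -1)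
    (fun V W => if Disjoint V W then
      (if ∀ x ∈ V, ∀ y ∈ W, G.Adj x y then (2 : ℝ) ^ (a * b) - 1 else -1) else 0)
    ha har hb hbr hD1 hDN' hsqrt' hC hτb hRdec hyp u' v'
  rw [Fintype.card_fin] at main
  -- conversion of the sums over subtypes
  have e1 : ∑ V ∈ powersetCard a (univ : Finset (Fin m)),
      (∑ W ∈ powersetCard b (univ : Finset (Fin m)), u' V * v' W *
        (if Disjoint V W then
          (if ∀ x ∈ V, ∀ y ∈ W, G.Adj x y then (2 : ℝ) ^ (a * b) - 1 else -1) else 0))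
      = ∑ A : {S : Finset (Fin m) // S.card = a},
          ∑ W ∈ powersetCard b (univ : Finset (Fin m)), u' A.1 * v' W *
            (if Disjoint A.1 W then
              (if ∀ x ∈ A.1, ∀ y ∈ W, G.Adj x y then (2 : ℝ) ^ (a * b) - 1 else -1) else 0) :=
    Finset.sum_subtype _ (fun S => mem_powersetCard_univ) (fun V =>
      ∑ W ∈ powersetCard b (univ : Finset (Fin m)), u' V * v' W *
        (if Disjoint V W then
          (if ∀ x ∈ V, ∀ y ∈ W, G.Adj x y then (2 : ℝ) ^ (a * b) - 1 else -1) else 0))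
  have e2 : ∀ V : Finset (Fin m),
      ∑ W ∈ powersetCard b (univ : Finset (Fin m)), u' V * v' W *
        (if Disjoint V W then
          (if ∀ x ∈ V, ∀ y ∈ W, G.Adj x y then (2 : ℝ) ^ (a * b) - 1 else -1) else 0)
      = ∑ B : {S : Finset (Fin m) // S.card = b}, u' V * v' B.1 *
        (if Disjoint V B.1 then
          (if ∀ x ∈ V, ∀ y ∈ B.1, G.Adj x y then (2 : ℝ) ^ (a * b) - 1 else -1) else 0) :=
    fun V => Finset.sum_subtype _ (fun S => mem_powersetCard_univ) (fun W => u' V * v' W *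
        (if Disjoint V W then
          (if ∀ x ∈ V, ∀ y ∈ W, G.Adj x y then (2 : ℝ) ^ (a * b) - 1 else -1) else 0))
  have hLHS : ∑ A : {S : Finset (Fin m) // S.card = a}, ∑ B : {S : Finset (Fin m) // S.card = b},
      u A * v B *
        (if Disjoint A.1 B.1 then
          (if ∀ x ∈ A.1, ∀ y ∈ B.1, G.Adj x y then (2 : ℝ) ^ (a * b) - 1 else -1) else 0)
      = ∑ V ∈ powersetCard a (univ : Finset (Fin m)),
          ∑ W ∈ powersetCard b (univ : Finset (Fin m)), u' V * v' W *
            (if Disjoint V W then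
              (if ∀ x ∈ V, ∀ y ∈ W, G.Adj x y then (2 : ℝ) ^ (a * b) - 1 else -1) else 0) := by
    rw [e1]
    refine Fintype.sum_congr _ _ fun A => ?_
    rw [e2]
    refine Fintype.sum_congr _ _ fun B => ?_
    rw [hu A, hv B]
  have hU : ∑ A : {S : Finset (Fin m) // S.card = a}, u A ^ 2
      = ∑ V ∈ powersetCard a (univ : Finset (Fin m)), u' V ^ 2 := by
    have e : ∑ V ∈ powersetCard a (univ : Finset (Fin m)), u' V ^ 2
        = ∑ A : {S : Finset (Fin m) // S.card = a}, u' A.1 ^ 2 :=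
      Finset.sum_subtype _ (fun S => mem_powersetCard_univ) (fun V => u' V ^ 2)
    rw [e]
    exact Fintype.sum_congr _ _ fun A => by rw [hu A]
  have hV : ∑ B : {S : Finset (Fin m) // S.card = b}, v B ^ 2
      = ∑ W ∈ powersetCard b (univ : Finset (Fin m)), v' W ^ 2 := by
    have e : ∑ W ∈ powersetCard b (univ : Finset (Fin m)), v' W ^ 2
        = ∑ B : {S : Finset (Fin m) // S.card = b}, v' B.1 ^ 2 :=
      Finset.sum_subtype _ (fun S => mem_powersetCard_univ) (fun W => v' W ^ 2)
    rw [e]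
    exact Fintype.sum_congr _ _ fun B => by rw [hv B]
  -- the final numerical inequality
  have hCN : (Cn : ℝ) ≤ (m : ℝ) ^ ((3 : ℝ) / 16) := by
    have h1 : ((Cn : ℝ) ^ 16) ≤ (m : ℝ) := by exact_mod_cast hm
    have h2 : ((Cn : ℝ) ^ 16) ^ ((3 : ℝ) / 16) ≤ (m : ℝ) ^ ((3 : ℝ) / 16) :=
      Real.rpow_le_rpow (by positivity) h1 (by norm_num)
    have h3 : ((Cn : ℝ) ^ 16) ^ ((3 : ℝ) / 16) = (Cn : ℝ) ^ 3 := by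
      rw [← Real.rpow_natCast (Cn : ℝ) 16, ← Real.rpow_mul (Nat.cast_nonneg Cn),
        show ((16 : ℕ) : ℝ) * ((3 : ℝ) / 16) = (3 : ℕ) by norm_num, Real.rpow_natCast]
    have h4 : (Cn : ℝ) ≤ (Cn : ℝ) ^ 3 := le_self_pow₀ (by exact_mod_cast hCn1) (by norm_num)
    linarith [h3 ▸ h2]
  have key : Real.sqrt (Cn * (m : ℝ) ^ (a + b - 1) * D)
      ≤ (m : ℝ) ^ (((a + b : ℕ) : ℝ) / 2 - 1 / 8) := by
    have hy0 : 0 ≤ (m : ℝ) ^ (((a + b : ℕ) : ℝ) / 2 - 1 / 8) := Real.rpow_nonneg hN0.le _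
    have hsq : ((m : ℝ) ^ (((a + b : ℕ) : ℝ) / 2 - 1 / 8)) ^ 2
        = (m : ℝ) ^ (a + b - 1) * (D * (m : ℝ) ^ ((3 : ℝ) / 16)) := by
      rw [← Real.rpow_natCast ((m : ℝ) ^ (((a + b : ℕ) : ℝ) / 2 - 1 / 8)) 2,
        ← Real.rpow_mul hN0.le, hD, ← Real.rpow_add hN0, ← Real.rpow_natCast (m : ℝ) (a + b - 1),
        ← Real.rpow_add hN0]
      congr 1
      have : ((a + b - 1 : ℕ) : ℝ) = (a + b : ℕ) - 1 := by
        rw [Nat.cast_sub (by omega)]; simp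
      rw [this]; push_cast; ring
    calc Real.sqrt (Cn * (m : ℝ) ^ (a + b - 1) * D)
        ≤ Real.sqrt (((m : ℝ) ^ (((a + b : ℕ) : ℝ) / 2 - 1 / 8)) ^ 2) := by
          refine Real.sqrt_le_sqrt ?_
          rw [hsq]
          calc (Cn : ℝ) * (m : ℝ) ^ (a + b - 1) * D = (m : ℝ) ^ (a + b - 1) * (D * Cn) := by ring
            _ ≤ (m : ℝ) ^ (a + b - 1) * (D * (m : ℝ) ^ ((3 : ℝ) / 16)) :=
                mul_le_mul_of_nonneg_left (mul_le_mul_of_nonneg_left hCN hD0) (by positivity)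
      _ = (m : ℝ) ^ (((a + b : ℕ) : ℝ) / 2 - 1 / 8) := Real.sqrt_sq hy0
  calc _ = |∑ V ∈ powersetCard a (univ : Finset (Fin m)),
          ∑ W ∈ powersetCard b (univ : Finset (Fin m)), u' V * v' W *
            (if Disjoint V W then
              (if ∀ x ∈ V, ∀ y ∈ W, G.Adj x y then (2 : ℝ) ^ (a * b) - 1 else -1) else 0)| := by
          rw [hLHS]
    _ ≤ _ := main
    _ ≤ (m : ℝ) ^ (((a + b : ℕ) : ℝ) / 2 - 1 / 8)
        * Real.sqrt (∑ V ∈ powersetCard a (univ : Finset (Fin m)), u' V ^ 2)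
        * Real.sqrt (∑ W ∈ powersetCard b (univ : Finset (Fin m)), v' W ^ 2) :=
          mul_le_mul_of_nonneg_right (mul_le_mul_of_nonneg_right key (Real.sqrt_nonneg _))
            (Real.sqrt_nonneg _)
    _ = _ := by rw [hU, hV]

end Summit.PneNP.PneNP.Theorems.PaleySosRungWeilPatch
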